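import Mathlib.RingTheory.MvPolynomial.Symmetric.FundamentalTheorem
import Mathlib.RingTheory.MvPolynomial.WeightedHomogeneous
import Mathlib.RingTheory.MvPolynomial.Homogeneous
import Mathlib.Data.Fintype.Perm
import HarnessLib

/-!
# Vector-valued symmetric forms are polynomials in the elementary symmetric functions

Topic `RingTheory/MvPolynomial`; namespace `Literature.RingTheory.MvPolynomial`.  THEOREMS ONLY
(no `def`, no instance, no notation, no axiom, no named fact, no `sorry`); Mathlib-only imports.

The algebraic layer («B1a») of the FORMAL step at the corner of the in-house Glaeser–Chevalley road
for `S₃` (cell `pub/hodgecm-mathlib`, N8-census §5 (9); road memo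
`F0/P3c/LH7/LH7-p01/g6/SIGFIRST-Glaeser3.v1.md`, brick B1; binder LH7-p01 (g6), this layer F0P3a-p09
(g9)): a homogeneous form of degree `d` on `Kⁿ` with coefficients in a `K`-vector space `M`, written
as a sum over words `w : Fin d → Fin n`, `x ↦ ∑_w (∏ₖ x_{w k}) • c_w`, whose coefficients are
invariant under the permutations of the letters (`c_{σ ∘ w} = c_w`) is `∑_w Q_w(e₁(x), …, eₙ(x)) • c_w`
for polynomials `Q_w` that are weighted-homogeneous of weight `d` (`deg eᵢ = i`).  Here `eᵢ` are
Mathlib's elementary symmetric polynomials `MvPolynomial.esymm`, and the existence of the `Q_w` is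
the fundamental theorem of symmetric polynomials (Mathlib's `MvPolynomial.esymmAlgHom_surjective`)
applied to the symmetrised word monomials `∑_σ ∏ₖ X_{σ (w k)}`, refined by the grading.  This is
the form in which the Taylor forms at a diagonal point of a smooth function symmetric in `n` real
variables (with values in a Banach space, coefficients depending on a parameter) are rewritten as
polynomials in the elementary symmetric functions.

* §1 the symmetrised word monomials: symmetric, homogeneous of degree `d`, their evaluation;
* §2 the averaging identity (needs `n!` invertible: `K` a field of characteristic zero);
* §3 the grading: `eₖ` is homogeneous of degree `k`; a weighted-homogeneous polynomial evaluated at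
  homogeneous polynomials of the weights' degrees is homogeneous; the graded fundamental theorem;
* §4 the head `exists_mvPolynomial_esymm_repr_of_perm_invariant` (binder's name) and the `c`-free per-word form
  `exists_isWeightedHomogeneous_aeval_esymm_eq_symmWord`.

## References

* [Macdonald1995] I. G. Macdonald, *Symmetric functions and Hall polynomials*, 2nd ed., Oxford
  (1995), Ch. I §2, (2.4) and the remark following it (`Λₙ = ℤ[e₁,…,eₙ]`, graded by degree, `eᵣ` of
  degree `r`): every homogeneous symmetric polynomial of degree `d` is a unique isobaric polynomial of
  weight `d` in `e₁, …, eₙ`.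
-/

open MvPolynomial Finset

namespace Literature.RingTheory.MvPolynomial

variable {R : Type*} [CommRing R] {n d : ℕ}

/-! ### §1 The symmetrised word monomials -/

/-- Renaming the symmetrised word monomial `∑_σ ∏ₖ X_{σ (w k)}` by a permutation permutes the
summands. [cite: Macdonald1995, Ch. I §2 (2.4)] -/
theorem rename_sum_perm_prod_X (τ : Equiv.Perm (Fin n)) (w : Fin d → Fin n) :
    rename τ (∑ σ : Equiv.Perm (Fin n), ∏ k, (X (σ (w k)) : MvPolynomial (Fin n) R)) =
      ∑ σ : Equiv.Perm (Fin n), ∏ k, X (σ (w k)) := by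
  simp only [map_sum, map_prod, rename_X]
  exact Fintype.sum_equiv (Equiv.mulLeft τ) _ _ fun σ => rfl

/-- The symmetrised word monomial is a symmetric polynomial. [cite: Macdonald1995, Ch. I §2 (2.4)] -/
theorem isSymmetric_sum_perm_prod_X (w : Fin d → Fin n) :
    (∑ σ : Equiv.Perm (Fin n), ∏ k, (X (σ (w k)) : MvPolynomial (Fin n) R)).IsSymmetric :=
  fun τ => rename_sum_perm_prod_X τ w

/-- The symmetrised word monomial of a word of length `d` is homogeneous of degree `d`.
[cite: Macdonald1995, Ch. I §2 (2.4)] -/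
theorem isHomogeneous_sum_perm_prod_X (w : Fin d → Fin n) :
    (∑ σ : Equiv.Perm (Fin n), ∏ k, (X (σ (w k)) : MvPolynomial (Fin n) R)).IsHomogeneous d := by
  refine IsHomogeneous.sum _ _ _ fun σ _ => ?_
  have h := IsHomogeneous.prod (univ : Finset (Fin d))
    (fun k => (X (σ (w k)) : MvPolynomial (Fin n) R)) (fun _ => 1) fun k _ => isHomogeneous_X R (σ (w k))
  simpa using h

/-- Evaluating the symmetrised word monomial. [cite: Macdonald1995, Ch. I §2 (2.4)] -/
theorem eval_sum_perm_prod_X (x : Fin n → R) (w : Fin d → Fin n) :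
    eval x (∑ σ : Equiv.Perm (Fin n), ∏ k, (X (σ (w k)) : MvPolynomial (Fin n) R)) =
      ∑ σ : Equiv.Perm (Fin n), ∏ k, x (σ (w k)) := by
  simp only [map_sum, map_prod, eval_X]

/-- Evaluation commutes with substitution: `(Q(g₁,…,gₙ))(x) = Q(g₁(x),…,gₙ(x))`.
[cite: Macdonald1995, Ch. I §2 (2.4)] -/
theorem eval_aeval_eq_aeval_eval {ι : Type*} (x : Fin n → R) (g : ι → MvPolynomial (Fin n) R)
    (Q : MvPolynomial ι R) : eval x (aeval g Q) = aeval (fun i => eval x (g i)) Q := by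
  rw [map_aeval, aeval_eq_eval₂Hom]
  exact eval₂Hom_congr (RingHom.ext fun r => by simp) rfl rfl

/-! ### §2 The averaging identity -/

section Averaging

variable {K : Type*} [Field K] [CharZero K] {M : Type*} [AddCommGroup M] [Module K M]

/-- Reindexing a sum over words by left composition with a permutation of the letters.
[cite: Macdonald1995, Ch. I §2 (2.4)] -/
theorem sum_comp_perm_eq (σ : Equiv.Perm (Fin n)) (F : (Fin d → Fin n) → M) :
    ∑ w : Fin d → Fin n, F (σ ∘ w) = ∑ w : Fin d → Fin n, F w :=
  Fintype.sum_equiv ((Equiv.refl (Fin d)).arrowCongr σ) _ _ fun _ => rfl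

/-- **Averaging.** If the coefficients `c_w ∈ M` of the form `x ↦ ∑_w (∏ₖ x_{w k}) • c_w` are
invariant under the permutations of the letters, the form equals
`∑_w ((n!)⁻¹ ∑_σ ∏ₖ x_{σ (w k)}) • c_w`. [cite: Macdonald1995, Ch. I §2 (2.4)] -/
theorem sum_prod_smul_eq_sum_symm_smul (c : (Fin d → Fin n) → M)
    (hc : ∀ (σ : Equiv.Perm (Fin n)) (w : Fin d → Fin n), c (σ ∘ w) = c w) (x : Fin n → K) :
    ∑ w : Fin d → Fin n, (∏ k, x (w k)) • c w =
      ∑ w : Fin d → Fin n, (((Fintype.card (Equiv.Perm (Fin n)) : K)⁻¹ *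
        ∑ σ : Equiv.Perm (Fin n), ∏ k, x (σ (w k))) • c w) := by
  classical
  -- for each `σ` the reindexed sum is the original one
  have hσ : ∀ σ : Equiv.Perm (Fin n),
      ∑ w : Fin d → Fin n, (∏ k, x (σ (w k))) • c w = ∑ w : Fin d → Fin n, (∏ k, x (w k)) • c w := by
    intro σ
    have h := sum_comp_perm_eq (M := M) σ (fun w => (∏ k, x (w k)) • c w)
    simpa only [Function.comp_apply, hc] using h
  have hN : ((Fintype.card (Equiv.Perm (Fin n)) : K)) ≠ 0 := Nat.cast_ne_zero.2 Fintype.card_ne_zero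
  -- average over `σ`
  have havg : (∑ w : Fin d → Fin n, (∏ k, x (w k)) • c w) =
      (Fintype.card (Equiv.Perm (Fin n)) : K)⁻¹ •
        (∑ σ : Equiv.Perm (Fin n), ∑ w : Fin d → Fin n, (∏ k, x (σ (w k))) • c w) := by
    simp only [hσ, sum_const, card_univ, ← Nat.cast_smul_eq_nsmul K, smul_smul, inv_mul_cancel₀ hN,
      one_smul]
  rw [havg, sum_comm, smul_sum]
  refine sum_congr rfl fun w _ => ?_
  rw [← smul_smul, sum_smul]

end Averaging

/-! ### §3 The grading -/

/-- The elementary symmetric polynomial `eₖ` is homogeneous of degree `k`. [cite: Macdonald1995, Ch. I §2 (2.2)] -/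
theorem esymm_isHomogeneous (σ : Type*) [Fintype σ] [DecidableEq σ] (R : Type*) [CommRing R]
    (k : ℕ) : (esymm σ R k).IsHomogeneous k := by
  simp only [esymm]
  refine IsHomogeneous.sum _ _ _ fun t ht => ?_
  have hcard : t.card = k := (mem_powersetCard.1 ht).2
  have h := IsHomogeneous.prod t (fun i => (X i : MvPolynomial σ R)) (fun _ => 1)
    fun i _ => isHomogeneous_X R i
  simpa [hcard] using h

/-- A weighted-homogeneous polynomial of weight `m`, evaluated at homogeneous polynomials whose
degrees are the weights, is homogeneous of degree `m`. [cite: Macdonald1995, Ch. I §2 (2.4)] -/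
theorem isHomogeneous_aeval_of_isWeightedHomogeneous {ι τ : Type*} {wt : ι → ℕ} {m : ℕ}
    {Q : MvPolynomial ι R} (hQ : Q.IsWeightedHomogeneous wt m) {g : ι → MvPolynomial τ R}
    (hg : ∀ i, (g i).IsHomogeneous (wt i)) : (aeval g Q).IsHomogeneous m := by
  classical
  rw [Q.as_sum, map_sum]
  refine IsHomogeneous.sum _ _ _ fun β hβ => ?_
  rw [aeval_monomial, Finsupp.prod]
  have hw : Finsupp.weight wt β = m := hQ (mem_support_iff.1 hβ)
  have hprod : (∏ i ∈ β.support, g i ^ β i).IsHomogeneous (∑ i ∈ β.support, wt i * β i) :=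
    IsHomogeneous.prod β.support (fun i => g i ^ β i) (fun i => wt i * β i)
      fun i _ => (hg i).pow (β i)
  have hdeg : ∑ i ∈ β.support, wt i * β i = m := by
    rw [← hw, Finsupp.weight_apply, Finsupp.sum]
    exact sum_congr rfl fun i _ => by rw [smul_eq_mul, mul_comm]
  have h := (isHomogeneous_C τ (coeff β Q)).mul hprod
  rw [zero_add, hdeg] at h
  simpa only [algebraMap_eq] using h

/-- **Graded fundamental theorem of symmetric polynomials.** A symmetric polynomial in `n`
variables which is homogeneous of degree `d` is `Q(e₁, …, eₙ)` for a polynomial `Q` that is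
weighted-homogeneous of weight `d` for the weights `deg eᵢ = i` (Mathlib's
`MvPolynomial.esymmAlgHom_surjective`, refined by the grading: the weight-`d` component of any
preimage is again a preimage). [cite: Macdonald1995, Ch. I §2 (2.4)] -/
theorem exists_isWeightedHomogeneous_aeval_esymm_eq {p : MvPolynomial (Fin n) R}
    (hp : p.IsSymmetric) (hd : p.IsHomogeneous d) :
    ∃ Q : MvPolynomial (Fin n) R, Q.IsWeightedHomogeneous (fun i : Fin n => (i : ℕ) + 1) d ∧
      aeval (fun i : Fin n => esymm (Fin n) R (i + 1)) Q = p := by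
  classical
  obtain ⟨Q₀, hQ₀⟩ := esymmAlgHom_surjective R (σ := Fin n) (n := n) (by simp) ⟨p, hp⟩
  set e : Fin n → MvPolynomial (Fin n) R := fun i => esymm (Fin n) R (i + 1) with he
  have hQ₀' : aeval e Q₀ = p := by
    have h := congrArg Subtype.val hQ₀
    rwa [esymmAlgHom_apply] at h
  set wt : Fin n → ℕ := fun i => (i : ℕ) + 1 with hwt
  have hehom : ∀ i, (e i).IsHomogeneous (wt i) := fun i => esymm_isHomogeneous (Fin n) R _
  refine ⟨weightedHomogeneousComponent wt d Q₀, weightedHomogeneousComponent_isWeightedHomogeneous d Q₀, ?_⟩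
  -- `Q₀` is the (finite) sum of its weighted-homogeneous components, and `aeval e` of the weight-`m`
  -- component is homogeneous of degree `m`; so `aeval e` of the weight-`d` component is the
  -- degree-`d` homogeneous component of `aeval e Q₀ = p`, which is `p`.
  have hfin : (Function.support fun m => weightedHomogeneousComponent wt m Q₀).Finite :=
    weightedHomogeneousComponent_finsupp Q₀
  have hQsum : ∑ m ∈ hfin.toFinset, weightedHomogeneousComponent wt m Q₀ = Q₀ := by
    rw [← finsum_eq_sum _ hfin]; exact sum_weightedHomogeneousComponent wt Q₀
  have hterm : ∀ m, homogeneousComponent d (aeval e (weightedHomogeneousComponent wt m Q₀)) =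
      if d = m then aeval e (weightedHomogeneousComponent wt m Q₀) else 0 := fun m =>
    homogeneousComponent_of_mem
      ((mem_homogeneousSubmodule _ _).2 (isHomogeneous_aeval_of_isWeightedHomogeneous
        (weightedHomogeneousComponent_isWeightedHomogeneous m Q₀) hehom))
  have hmain : homogeneousComponent d (aeval e Q₀) = aeval e (weightedHomogeneousComponent wt d Q₀) := by
    conv_lhs => rw [← hQsum]
    rw [map_sum, map_sum]
    simp only [hterm, Finset.sum_ite_eq]
    split_ifs with hdS
    · rfl
    · have h0 : weightedHomogeneousComponent wt d Q₀ = 0 := by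
        simpa [Set.Finite.mem_toFinset, Function.mem_support] using hdS
      rw [h0, map_zero]
  rw [← hmain, hQ₀', homogeneousComponent_eq_self hd]

/-! ### §4 The head -/

/-- **The symmetrised word monomial is an isobaric polynomial in the elementary symmetric
functions**: for every word `w : Fin d → Fin n` there is `Q_w`, weighted-homogeneous of weight `d`
for `deg eᵢ = i`, with `Q_w(e₁, …, eₙ) = (n!)⁻¹ ∑_σ ∏ₖ X_{σ (w k)}` (`Q_w` depends on `(n, d, w)`
only). [cite: Macdonald1995, Ch. I §2 (2.4)] -/
theorem exists_isWeightedHomogeneous_aeval_esymm_eq_symmWord {K : Type*} [Field K]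
    (w : Fin d → Fin n) :
    ∃ Q : MvPolynomial (Fin n) K, Q.IsWeightedHomogeneous (fun i : Fin n => (i : ℕ) + 1) d ∧
      aeval (fun i : Fin n => esymm (Fin n) K (i + 1)) Q =
        C ((Fintype.card (Equiv.Perm (Fin n)) : K)⁻¹) *
          ∑ σ : Equiv.Perm (Fin n), ∏ k, X (σ (w k)) :=
  exists_isWeightedHomogeneous_aeval_esymm_eq
    ((IsSymmetric.C _).mul (isSymmetric_sum_perm_prod_X w)) ((isHomogeneous_sum_perm_prod_X w).C_mul _)

/-- **Vector-valued symmetric forms are polynomials in the elementary symmetric functions**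
(«Chevalley for Taylor forms with vector coefficients», the algebraic half of the formal step of
the smooth Newton theorem).  For coefficients `c_w ∈ M` (`w : Fin d → Fin n`, `M` a vector space over
a field `K` of characteristic zero) invariant under the permutations of the letters there are
polynomials `Q_w` (those of `exists_isWeightedHomogeneous_aeval_esymm_eq_symmWord`, independent of
`c`), weighted-homogeneous of weight `d` for `deg eᵢ = i`, with
`∑_w (∏ₖ x_{w k}) • c_w = ∑_w Q_w(e₁(x), …, eₙ(x)) • c_w` for all `x ∈ Kⁿ`.
[cite: Macdonald1995, Ch. I §2 (2.4)] -/
theorem exists_mvPolynomial_esymm_repr_of_perm_invariant {K : Type*} [Field K] [CharZero K]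
    {M : Type*} [AddCommGroup M] [Module K M] (c : (Fin d → Fin n) → M)
    (hc : ∀ (σ : Equiv.Perm (Fin n)) (w : Fin d → Fin n), c (σ ∘ w) = c w) :
    ∃ Q : (Fin d → Fin n) → MvPolynomial (Fin n) K,
      (∀ w, (Q w).IsWeightedHomogeneous (fun i : Fin n => (i : ℕ) + 1) d) ∧
      ∀ x : Fin n → K, ∑ w : Fin d → Fin n, (∏ k, x (w k)) • c w =
        ∑ w : Fin d → Fin n,
          (aeval (fun i : Fin n => eval x (esymm (Fin n) K (i + 1))) (Q w)) • c w := by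
  classical
  choose Q hQw hQ using fun w : Fin d → Fin n =>
    exists_isWeightedHomogeneous_aeval_esymm_eq_symmWord (K := K) w
  refine ⟨Q, hQw, fun x => ?_⟩
  rw [sum_prod_smul_eq_sum_symm_smul c hc x]
  refine sum_congr rfl fun w _ => ?_
  congr 1
  have h := congrArg (eval x) (hQ w)
  rw [map_mul, eval_C, eval_sum_perm_prod_X] at h
  rw [← h, eval_aeval_eq_aeval_eval]

/-- The same with the right-hand side spelled through `MvPolynomial.eval` (the binder's spelling).
[cite: Macdonald1995, Ch. I §2 (2.4)] -/
theorem exists_mvPolynomial_esymm_repr_of_perm_invariant_eval {K : Type*} [Field K] [CharZero K]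
    {M : Type*} [AddCommGroup M] [Module K M] (c : (Fin d → Fin n) → M)
    (hc : ∀ (σ : Equiv.Perm (Fin n)) (w : Fin d → Fin n), c (σ ∘ w) = c w) :
    ∃ Q : (Fin d → Fin n) → MvPolynomial (Fin n) K,
      (∀ w, (Q w).IsWeightedHomogeneous (fun i : Fin n => (i : ℕ) + 1) d) ∧
      ∀ x : Fin n → K, ∑ w : Fin d → Fin n, (∏ k, x (w k)) • c w =
        ∑ w : Fin d → Fin n,
          (eval (fun i : Fin n => eval x (esymm (Fin n) K (i + 1))) (Q w)) • c w := by
  obtain ⟨Q, hQw, hQ⟩ := exists_mvPolynomial_esymm_repr_of_perm_invariant (K := K) c hc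
  refine ⟨Q, hQw, fun x => ?_⟩
  rw [hQ x]
  rfl

end Literature.RingTheory.MvPolynomial
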